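import Literature.NumberTheory.EllipticCurves.FormalGroupLubinTateLogarithmDegreeOne
import Literature.NumberTheory.NumberFields.AdicCompletionIntegersPadicIntOfDegreeOne
import Literature.NumberTheory.NumberFields.RayClassFieldAdicCharacterLocalUnits
import Mathlib.Algebra.CharP.Algebra
import HarnessLib

/-!
# `log_W ∘ ([1]_{P′,f} ∘ [a]_f) = a·λ_f` AT A PLACE OF DEGREE ONE OF A NUMBER FIELD: the `ℤ_p`-datum `P ↦ [π] = exp_W(π·log_W)`
# read in `K_v` through `K_v ≃ ℚ_p` gives the hypothesis `hlog` — nothing about `ℚ_p` is left to the (e)-assembler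
# (de Shalit II §1.1 «`𝒪_𝔭 = ℤ_p`», II §4.9 «`λ_Ê`»; proofs only)

Topic `NumberTheory/EllipticCurves` (theorems only; no definition, no named fact, no instance).  Sequel of
`FormalGroupLubinTateLogarithmDegreeOne.lean` (§1 `formalLog_subst_map_eq_C_mul_of_map_eq_formalExp_subst` for any
`φ : ℚ_p → B`; §2 `formalLog_map_subst_map_subst_hom_eq` under `hlog : log_W ∘ P′ = π·log_W`) at the cell's frame: `K` a number
field, `v ∣ p` a place of DEGREE ONE (`e = f = 1`), `F := K_v`, the integer identification
`e := (integerEquivAdicCompletionIntegers v).trans (padicIntEquivOfDegreeOne K p v he hf) : 𝒪[K_v] ≃+* ℤ_p` of the measure lane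
(`PAdicOneVariableSeriesFamilyRelSupply`, `FormalGroupLubinTateDivisionPointsDegreeOne` §1: `P′ := P.map (LTCoeff.of ∘ e⁻¹)`) and the
FIELD identification `padicEquivOfDegreeOne K p v he hf : K_v ≃+* ℚ_p` (`AdicCompletionIntegersPadicIntOfDegreeOne`,
`coe_padicIntEquivOfDegreeOne_apply`: the two are compatible).  PROVED here (0 sorry):

* `padicEquivOfDegreeOne_symm_comp_coe` — **`eK⁻¹ ∘ (ℤ_p ⊂ ℚ_p) = (𝒪[K_v] ⊂ K_v) ∘ e⁻¹`**; `map_map_LTCoeff_eq_map_of_degree_one` —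
  `(P.map (LTCoeff.of ∘ e⁻¹)).map τ_F = P.map (eK⁻¹ ∘ Coe)` (`τ_F : LTCoeff F → 𝒪_F → F`);
* ★★ `formalLog_subst_map_map_LTCoeff_eq_of_degree_one` — for `V/ℤ_p` and an integral lift `P` of `[c] = exp_W(c·log_W)`
  (`P.map Coe = exp.subst (C c * log)`, the `hP` of `X049FormalGroupLubinTateTwo.cm7Padic_exists_formalGroupLaw_eq_ltF` /
  `OrdinaryFormalGroupLubinTate.exists_isLTSeries_formalGroupLaw_eq_ltF`), with `W := V.map (eK⁻¹ ∘ Coe)` over `K_v`: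
  **`log_W ∘ (P′ read in K_v) = (e⁻¹ c) · log_W`** — the hypothesis `hlog` of §2 of the previous file, at `π := e⁻¹ c`;
* ★★★ `formalLog_map_subst_map_subst_hom_eq_of_degree_one` — **the `hcompat` of the moment identification
  (`LubinTateColemanRelativeMomentLogCoordinateTwo.map_constantCoeff_iterate_relDerivation_relLogDerivSeries_of_eq_subst_subst`)
  DISCHARGED at a place of degree one from the `ℤ_p`-datum alone**: for `π ∈ 𝒪[K_v]` with `e π = c`, ANY Lubin–Tate proof `hP′` for
  `P′ = P.map (LTCoeff.of ∘ e⁻¹)`, any `K_v`-algebra `B` (a `ℚ`-algebra) and `a ∈ LTCoeff K_v`: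
  `log_{W^B} ∘ ((PowerSeries.subst [a]_f [1]_{P′,f})^{τ_B}) = C (τ_B a) · λ_f^B` with `W^B = (V.map (eK⁻¹ ∘ Coe)).map (K_v → B)`
  — at `K = ℚ(√−7)`, `v ∣ 2`, `V = 49a1 ⊗ ℤ₂` this is `[1,−1,0,−2,−1]` over `B`.

Cell `bsd-print-cf2`, width seat `bsd-line-cf2-p1-w2` g24 (piece MI-1d); no summit statement is proved; BSD is not proved by any of this.

## References
* [deShalit1987] E. de Shalit, *Iwasawa theory of elliptic curves with complex multiplication* (1987), II §1.1 (p. 32), II §1.10, II §4.9.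
* [FrohlichTaylor1990] A. Fröhlich, M. J. Taylor, *Algebraic Number Theory* (1991), Ch. III §1 (1.14)(a).
* [LubinTate1965] J. Lubin, J. Tate, *Formal complex multiplication in local fields*, Ann. of Math. 81 (1965), §1 Thm. 1 (9).
-/

noncomputable section

open scoped Classical
open PowerSeries IsDedekindDomain NumberField ValuativeRel
open Literature.NumberTheory.NumberFields Literature.NumberTheory.GaloisRepresentations
  Literature.NumberTheory.GaloisRepresentations.IsNonarchimedeanLocalField Literature.NumberTheory.GaloisRepresentations.LubinTate

namespace Literature.NumberTheory.EllipticCurves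

variable (K : Type) [Field K] [NumberField K] (p : ℕ) [hp : Fact p.Prime] (v : HeightOneSpectrum (𝓞 K))
  [v.asIdeal.LiesOver (ratPlace p).asIdeal]
  (he : v.asIdeal.ramificationIdx (𝓞 ℚ) = 1) (hf : v.asIdeal.inertiaDeg (𝓞 ℚ) = 1)

attribute [local instance] ltNormUniformSpace ltNormIsUniformAddGroup rk1 nF nE fintypeResidueField

/-- **`eK⁻¹ ∘ (ℤ_p ⊂ ℚ_p) = (𝒪[K_v] ⊂ K_v) ∘ e⁻¹`** for the field identification `eK : K_v ≃ ℚ_p` and the integer identification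
`e = (§1).trans e𝒪 : 𝒪[K_v] ≃ ℤ_p` at a place of degree one (`coe_padicIntEquivOfDegreeOne_apply`).
[cite: FrohlichTaylor1990, Ch. III §1 (1.14)(a)] [cite: deShalit1987, II §1.1] -/
theorem padicEquivOfDegreeOne_symm_comp_coe :
    ((padicEquivOfDegreeOne K p v he hf).symm.toRingHom).comp (PadicInt.Coe.ringHom (p := p)) =
      (algebraMap 𝒪[v.adicCompletion K] (v.adicCompletion K)).comp
        ((integerEquivAdicCompletionIntegers v).trans (padicIntEquivOfDegreeOne K p v he hf)).symm.toRingHom := by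
  refine RingHom.ext fun z => ?_
  set x : 𝒪[v.adicCompletion K] := ((integerEquivAdicCompletionIntegers v).trans (padicIntEquivOfDegreeOne K p v he hf)).symm z
    with hx
  have hz : z = padicIntEquivOfDegreeOne K p v he hf (integerEquivAdicCompletionIntegers v x) := by
    rw [hx, ← RingEquiv.trans_apply, RingEquiv.apply_symm_apply]
  rw [RingHom.comp_apply, RingHom.comp_apply, RingEquiv.toRingHom_eq_coe, RingEquiv.toRingHom_eq_coe, RingHom.coe_coe,
    RingHom.coe_coe, ← hx, RingEquiv.symm_apply_eq, hz]
  change ((padicIntEquivOfDegreeOne K p v he hf (integerEquivAdicCompletionIntegers v x) : ℤ_[p]) : ℚ_[p]) = _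
  rw [coe_padicIntEquivOfDegreeOne_apply, coe_integerEquivAdicCompletionIntegers]
  rfl

/-- `(P.map (LTCoeff.of ∘ e⁻¹)).map (LTCoeff F → 𝒪_F → F) = P.map (eK⁻¹ ∘ Coe)`: the lane's `P′` read in `K_v` is `P` read through
`ℚ_p ≃ K_v`. [cite: FrohlichTaylor1990, Ch. III §1 (1.14)(a)] [cite: deShalit1987, II §1.1] -/
theorem map_map_LTCoeff_eq_map_of_degree_one (P : PowerSeries ℤ_[p]) :
    (P.map ((LTCoeff.of (v.adicCompletion K)).toRingHom.comp
        ((integerEquivAdicCompletionIntegers v).trans (padicIntEquivOfDegreeOne K p v he hf)).symm.toRingHom)).map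
      ((algebraMap 𝒪[v.adicCompletion K] (v.adicCompletion K)).comp (LTCoeff.of (v.adicCompletion K)).symm.toRingHom) =
      P.map (((padicEquivOfDegreeOne K p v he hf).symm.toRingHom).comp (PadicInt.Coe.ringHom (p := p))) := by
  rw [← RingHom.comp_apply (PowerSeries.map _) (PowerSeries.map _), ← PowerSeries.map_comp, padicEquivOfDegreeOne_symm_comp_coe]
  congr 1

/-- ★★ **`hlog` at a place of degree one**: for `V/ℤ_p` and an integral lift `P` of `[c] = exp_W(c·log_W)` (`W = V ⊗ ℚ_p`), with
`W_v := V.map (eK⁻¹ ∘ Coe)` over `K_v`: `log_{W_v} ∘ (P′ read in K_v) = (e⁻¹ c)·log_{W_v}`, `P′ = P.map (LTCoeff.of ∘ e⁻¹)` the lane's series.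
[cite: deShalit1987, Ch. I §1.2, II §1.1, II §4.9] [cite: FrohlichTaylor1990, Ch. III §1 (1.14)(a)] -/
theorem formalLog_subst_map_map_LTCoeff_eq_of_degree_one (V : WeierstrassCurve ℤ_[p]) {c : ℤ_[p]} {P : PowerSeries ℤ_[p]}
    (hP : P.map PadicInt.Coe.ringHom =
      (V.map PadicInt.Coe.ringHom).formalExp.subst (C (c : ℚ_[p]) * (V.map PadicInt.Coe.ringHom).formalLog)) :
    (V.map (((padicEquivOfDegreeOne K p v he hf).symm.toRingHom).comp (PadicInt.Coe.ringHom (p := p)))).formalLog.subst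
        ((P.map ((LTCoeff.of (v.adicCompletion K)).toRingHom.comp
          ((integerEquivAdicCompletionIntegers v).trans (padicIntEquivOfDegreeOne K p v he hf)).symm.toRingHom)).map
          ((algebraMap 𝒪[v.adicCompletion K] (v.adicCompletion K)).comp (LTCoeff.of (v.adicCompletion K)).symm.toRingHom)) =
      C (((((integerEquivAdicCompletionIntegers v).trans (padicIntEquivOfDegreeOne K p v he hf)).symm c :
          𝒪[v.adicCompletion K]) : v.adicCompletion K)) *
        (V.map (((padicEquivOfDegreeOne K p v he hf).symm.toRingHom).comp (PadicInt.Coe.ringHom (p := p)))).formalLog := by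
  rw [map_map_LTCoeff_eq_map_of_degree_one K p v he hf P,
    formalLog_subst_map_eq_C_mul_of_map_eq_formalExp_subst V hP ((padicEquivOfDegreeOne K p v he hf).symm.toRingHom)]
  congr 2
  exact RingHom.congr_fun (padicEquivOfDegreeOne_symm_comp_coe K p v he hf) c

/-- ★★★ **The `hcompat` of the moment identification DISCHARGED at a place of degree one** from the `ℤ_p`-datum
`P ↦ [c] = exp_W(c·log_W)` alone: for `π ∈ 𝒪[K_v]` with `e π = c` (so `π` is the lane's uniformiser when `c = a − ϖ`), ANY
Lubin–Tate proof `hP′` for `P′ = P.map (LTCoeff.of ∘ e⁻¹)`, any `K_v`-algebra `B` that is a `ℚ`-algebra, and any `a ∈ LTCoeff K_v`: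
`log_{W^B} ∘ ((PowerSeries.subst [a]_f [1]_{P′,f})^{τ_B}) = C (τ_B a) · λ_f^B`, `W^B := (V.map (eK⁻¹ ∘ Coe)).map (K_v → B)` —
LITERALLY the hypothesis `hcompat` of `map_constantCoeff_iterate_relDerivation_relLogDerivSeries_of_eq_subst_subst` with
`Λ := log_{W^B}`, `H₁ := [1]_{P′,f}`, `H₂ := [a]_f`, `b := τ_B a`. [cite: deShalit1987, Ch. I §1.2, II §1.1, II §4.9]
[cite: LubinTate1965, §1 Thm. 1 (9)] -/
theorem formalLog_map_subst_map_subst_hom_eq_of_degree_one (V : WeierstrassCurve ℤ_[p]) {c : ℤ_[p]} {P : PowerSeries ℤ_[p]}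
    (hP : P.map PadicInt.Coe.ringHom =
      (V.map PadicInt.Coe.ringHom).formalExp.subst (C (c : ℚ_[p]) * (V.map PadicInt.Coe.ringHom).formalLog))
    {π : 𝒪[v.adicCompletion K]} (hπ : (valuation (v.adicCompletion K)).IsUniformizer (π : v.adicCompletion K))
    (heπ : ((integerEquivAdicCompletionIntegers v).trans (padicIntEquivOfDegreeOne K p v he hf)) π = c)
    (hP' : IsLTSeries (LTCoeff.of (v.adicCompletion K) π) (residueFieldCard (v.adicCompletion K))
      (P.map ((LTCoeff.of (v.adicCompletion K)).toRingHom.comp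
        ((integerEquivAdicCompletionIntegers v).trans (padicIntEquivOfDegreeOne K p v he hf)).symm.toRingHom)))
    {B : Type*} [CommRing B] [Algebra ℚ B] [Algebra (v.adicCompletion K) B] (a : LTCoeff (v.adicCompletion K)) :
    ((V.map (((padicEquivOfDegreeOne K p v he hf).symm.toRingHom).comp (PadicInt.Coe.ringHom (p := p)))).map
          (algebraMap (v.adicCompletion K) B)).formalLog.subst
        (PowerSeries.map ((algebraMap (v.adicCompletion K) B).comp
            ((algebraMap 𝒪[v.adicCompletion K] (v.adicCompletion K)).comp (LTCoeff.of (v.adicCompletion K)).symm.toRingHom))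
          (PowerSeries.subst
            (hom (isLTRing_LTCoeff hπ) (isLTSeries_LTCoeff π) (isLTSeries_LTCoeff π) a)
            (hom (isLTRing_LTCoeff hπ) hP' (isLTSeries_LTCoeff π) 1))) =
      C (((algebraMap (v.adicCompletion K) B).comp
            ((algebraMap 𝒪[v.adicCompletion K] (v.adicCompletion K)).comp (LTCoeff.of (v.adicCompletion K)).symm.toRingHom)) a) *
        (ltLog hπ).map (algebraMap (v.adicCompletion K) B) := by
  haveI : CharZero (v.adicCompletion K) :=
    charZero_of_injective_algebraMap (algebraMap K (v.adicCompletion K)).injective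
  have hπc : (((((integerEquivAdicCompletionIntegers v).trans (padicIntEquivOfDegreeOne K p v he hf)).symm c :
      𝒪[v.adicCompletion K]) : v.adicCompletion K)) = ((π : 𝒪[v.adicCompletion K]) : v.adicCompletion K) := by
    rw [← heπ, RingEquiv.symm_apply_apply]
  have hlog := formalLog_subst_map_map_LTCoeff_eq_of_degree_one K p v he hf V hP
  rw [hπc] at hlog
  exact formalLog_map_subst_map_subst_hom_eq hπ hP'
    (V.map (((padicEquivOfDegreeOne K p v he hf).symm.toRingHom).comp (PadicInt.Coe.ringHom (p := p))))
    (by convert hlog using 3 <;> exact Subsingleton.elim _ _) a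

end Literature.NumberTheory.EllipticCurves

end
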